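import Literature.MathematicalPhysics.QuantumLattice.AngularCutoffLineBounds
import Literature.MathematicalPhysics.QuantumLattice.SectorCutoffLineBounds
import Literature.MathematicalPhysics.QuantumLattice.TorusSymbolClassDecay
import Literature.Analysis.Calculus.IteratedDerivLeibnizBound
import HarnessLib

/-!
# Sectorised covariance symbols `ζ̃_{ω₁}ζ̃_{ω₂}σ_ω` on the discrete torus: the bounds of Lemma 2.2 for the products

Topic `MathematicalPhysics/QuantumLattice`.  Benfatto–Giuliani–Mastropietro 2006, §2.7 (2.66)–(2.71a): after the
sector decomposition the covariance of the sector fields `ψ_{x,ω}` carries, besides the single-scale sector symbol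
`σ_ω = F_{h,ω}χ/D`, an ANGULAR cutoff on each leg (the fat sector functions `F̃_ω`, sums of the
`ζ̃_{h,ω'}(θ(k⃗)) = sectorWeightCirc n ω' (polarAngle k⃗)`), and BGM use for these products "the same bounds"
(2.50)–(2.52) as for `g_ω^{(h)}`.  PROVED here, at finite `(β, L)`, for `-4 < μ < -2-√2`:

* `closure_sectorSymbol_region` — on the closure of `{σ_{n,ω} ≠ 0}`: `‖k⃗‖ ≥ √((4+μ)/2)` and the relative angle
  to the sector centre is `≤ ¾ w_n` (so off the cut);
* `contDiff_radial_mul_sectorWeightCirc_polarAngle` — the angular cutoff times a radial plateau is smooth on `ℝ²`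
  (analysis device: it agrees with the angular cutoff on the Fermi region);
* **`exists_allorder_sectorProductSymbol_line_le`** — all-order line bounds `4ⁿ B' ρ_ω(w)ⁱ` for
  `σ_ω · (Â_{ω₁} Â_{ω₂})` (Leibniz: `σ_ω` from `SectorCutoffLineBounds`, angular factors from
  `AngularCutoffLineBounds`, `2ⁿ‖w⃗‖ ≤ 2ρ_ω(w)`);
* **`torusSectorProductSum_bounds`** — the conclusions of `torusCharSum_bounds_of_symbolClass` for the sampled
  product symbol `σ_ω(k) ζ̃_{ω₁}(θ(k⃗)) ζ̃_{ω₂}(θ(k⃗))`, for ALL `ω₁, ω₂ ∈ ℤ`, uniformly: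
  sup `≤ C βL² 4^{-n}2^{-n}` and weighted `L¹` `≤ C βL² 4ⁿ` — i.e. `|g| ≤ Cγ^{3h/2}`, `∫(1+γ^h|x|)^{N_w}|g| ≤ Cγ^{-h}`
  for every entry of the sectorised covariance.

Everything is proved; no definitions, no named facts.

## Sources

G. Benfatto, A. Giuliani, V. Mastropietro, Ann. Henri Poincaré 7 (2006) 809–898, §2.5 Lemma 2.2, §2.7 (2.66)–(2.71a)
(`BenfattoGiulianiMastropietro2006`).
-/

noncomputable section

open Real Set Filter Complex Literature.Analysis.SpecialFunctions Literature.Analysis.Calculus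
  Literature.Probability.LatticeModels
open scoped Nat Topology

namespace Literature.MathematicalPhysics.QuantumLattice

/-! ### Generic pieces -/

/-- `‖k₁ + ik₂‖ ≤ |k₁| + |k₂|`. [folklore] -/
theorem norm_momToComplex_le (w : Fin 2 → ℝ) : ‖momToComplex w‖ ≤ |w 0| + |w 1| := by
  rw [show ‖momToComplex w‖ = Real.sqrt (‖momToComplex w‖ ^ 2) from (Real.sqrt_sq (norm_nonneg _)).symm,
    norm_momToComplex_sq]
  calc Real.sqrt (w 0 ^ 2 + w 1 ^ 2) ≤ Real.sqrt ((|w 0| + |w 1|) ^ 2) :=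
        Real.sqrt_le_sqrt (by nlinarith [abs_nonneg (w 0), abs_nonneg (w 1), sq_abs (w 0), sq_abs (w 1)])
    _ = |w 0| + |w 1| := Real.sqrt_sq (by positivity)

/-- **The angular cutoff times a radial plateau is smooth on all of `ℝ²`** (near `k⃗ = 0` the radial factor
vanishes identically; elsewhere the polar angle is smooth through the periodic profile). [folklore] -/
theorem contDiff_radial_mul_sectorWeightCirc_polarAngle {r : ℝ} (hr : 0 < r) (n : ℕ) (ω : ℤ) {m : ℕ∞} :
    ContDiff ℝ m (fun k : Fin 2 → ℝ => radialCutoffC r (momToComplex k) * sectorWeightCirc n ω (polarAngle k)) := by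
  refine contDiff_iff_contDiffAt.2 fun k => ?_
  by_cases hk : k = 0
  · subst hk
    have h0 : momToComplex (0 : Fin 2 → ℝ) = 0 := (momToComplex_eq_zero_iff 0).2 rfl
    have hcont : ContinuousAt momToComplex (0 : Fin 2 → ℝ) := contDiff_momToComplex (m := 0) |>.continuous.continuousAt
    have hev : ∀ᶠ k : Fin 2 → ℝ in 𝓝 0, radialCutoffC r (momToComplex k) = 0 := by
      have h := radialCutoffC_eventuallyEq_zero hr
      rw [← h0] at h
      exact hcont.eventually h
    have hev' : (fun k : Fin 2 → ℝ => radialCutoffC r (momToComplex k) * sectorWeightCirc n ω (polarAngle k)) =ᶠ[𝓝 0]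
        fun _ => 0 := by
      filter_upwards [hev] with k hk
      rw [hk, zero_mul]
    exact (contDiffAt_const (c := (0 : ℝ))).congr_of_eventuallyEq hev'
  · exact (((contDiff_radialCutoffC r).comp contDiff_momToComplex).contDiffAt).mul
      (contDiffAt_sectorWeightCirc_polarAngle n ω hk)

/-- Powers of a scaled cost: `(cρ)ʲ ≤ (max 1 c)ᴺ ρʲ` for `j ≤ N`. [folklore] -/
theorem mul_pow_le_max_pow_mul {c ρ : ℝ} (hc : 0 ≤ c) (hρ : 0 ≤ ρ) {j N : ℕ} (hj : j ≤ N) :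
    (c * ρ) ^ j ≤ (max 1 c) ^ N * ρ ^ j := by
  rw [mul_pow]
  refine mul_le_mul_of_nonneg_right ?_ (pow_nonneg hρ j)
  calc c ^ j ≤ (max 1 c) ^ j := pow_le_pow_left₀ hc (le_max_right _ _) j
    _ ≤ (max 1 c) ^ N := pow_le_pow_right₀ (le_max_left _ _) hj

/-- The Leibniz constant: `2ⁱ (xB)(2ᴺ X) r ≤ x (4ᴺ B X) r` for `i ≤ N`. [folklore] -/
theorem leibniz_product_constant_arith {x B X r : ℝ} {i N : ℕ} (hx : 0 ≤ x) (hB : 0 ≤ B) (hX : 0 ≤ X) (hr : 0 ≤ r)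
    (hi : i ≤ N) : 2 ^ i * (x * B) * (2 ^ N * X) * r ≤ x * (4 ^ N * B * X) * r := by
  have h2i : (2 : ℝ) ^ i ≤ 2 ^ N := pow_le_pow_right₀ (by norm_num) hi
  have h4 : (4 : ℝ) ^ N = 2 ^ N * 2 ^ N := by rw [← mul_pow]; norm_num
  rw [h4]
  calc 2 ^ i * (x * B) * (2 ^ N * X) * r = 2 ^ i * (2 ^ N * (x * B * X * r)) := by ring
    _ ≤ 2 ^ N * (2 ^ N * (x * B * X * r)) := mul_le_mul_of_nonneg_right h2i (by positivity)
    _ = x * (2 ^ N * 2 ^ N * B * X) * r := by ring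

/-! ### The region of the sector symbol -/

section Region

variable {μ : ℝ} (hμ₁ : -4 < μ) (hμ₂ : μ < -2 - Real.sqrt 2)
include hμ₁ hμ₂

omit hμ₁ hμ₂ in
/-- **Momenta near the Fermi curve are bounded away from zero**: `|ε(k⃗) - μ| < (4+μ)/2 ⟹ ‖k⃗‖ ≥ √((4+μ)/2)`
(`ε + 4 = 2(1 - cos k₁) + 2(1 - cos k₂) ≤ ‖k⃗‖²`). [folklore] -/
theorem sqrt_le_norm_momToComplex_of_abs_sub_lt {k : Fin 2 → ℝ} (h : |sqDispersion k - μ| < (4 + μ) / 2) :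
    Real.sqrt ((4 + μ) / 2) ≤ ‖momToComplex k‖ := by
  have h1 := Real.one_sub_sq_div_two_le_cos (x := k 0)
  have h2 := Real.one_sub_sq_div_two_le_cos (x := k 1)
  have hε : sqDispersion k = -2 * (Real.cos (k 0) + Real.cos (k 1)) := rfl
  have hlow : (4 + μ) / 2 ≤ k 0 ^ 2 + k 1 ^ 2 := by
    have := (abs_lt.1 h).1
    nlinarith
  rw [show ‖momToComplex k‖ = Real.sqrt (‖momToComplex k‖ ^ 2) from (Real.sqrt_sq (norm_nonneg _)).symm,
    norm_momToComplex_sq]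
  exact Real.sqrt_le_sqrt hlow

omit hμ₁ hμ₂ in
/-- **On the support of the sector symbol**: `‖k⃗‖ ≥ √((4+μ)/2)` and the relative angle to the sector centre is
`< ¾ w_n`. [cite: BenfattoGiulianiMastropietro2006, §2.5 (2.45)–(2.50)] -/
theorem sectorSymbol_ne_zero_region {e₀ : ℝ} (he : 0 < e₀) (he' : e₀ ≤ (4 + μ) / 2) {n : ℕ} {ω : ℤ}
    {p : ℝ × (Fin 2 → ℝ)} (h : sectorSymbol e₀ μ n ω p ≠ 0) :
    Real.sqrt ((4 + μ) / 2) ≤ ‖momToComplex p.2‖ ∧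
      |sectorRelAngle (((ω : ℝ) + 1 / 2) * sectorWidth n) p.2| < 3 * sectorWidth n / 4 := by
  have hF := (anisotropicCutoff_ne_zero_of_sectorSymbol_ne_zero h).1
  -- scale: `|ε - μ| ≤ √(k₀² + (ε-μ)²) < e₀4^{-n} ≤ e₀ ≤ (4+μ)/2`
  have hs := (anisotropicCutoff_ne_zero_scale he hF).2
  have habs : |sqDispersion p.2 - μ| < (4 + μ) / 2 := by
    have h1 : |sqDispersion p.2 - μ| ≤ Real.sqrt (p.1 ^ 2 + (sqDispersion p.2 - μ) ^ 2) :=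
      Real.abs_le_sqrt (by nlinarith [sq_nonneg p.1])
    have h2 : e₀ * (4 : ℝ) ^ (-(n : ℤ)) ≤ e₀ :=
      mul_le_of_le_one_right he.le (zpow_le_one_of_nonpos₀ (by norm_num) (by simp))
    linarith
  have hr := sqrt_le_norm_momToComplex_of_abs_sub_lt habs
  refine ⟨hr, ?_⟩
  -- angle: the angular factor is `W(Θ/w_n)`, which vanishes for `|Θ/w_n| ≥ 3/4`
  have hr₀ : 0 < Real.sqrt ((4 + μ) / 2) := Real.sqrt_pos.2 (by linarith)
  have hk : p.2 ≠ 0 := by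
    intro h0
    have : momToComplex p.2 = 0 := (momToComplex_eq_zero_iff _).2 h0
    rw [this, norm_zero] at hr
    linarith
  have hζ : sectorWeightCirc n ω (polarAngle p.2) ≠ 0 := right_ne_zero_of_mul hF
  rw [sectorWeightCirc_polarAngle_eq n ω hk] at hζ
  have hw := sectorWidth_pos n
  by_contra hc
  rw [not_lt] at hc
  apply hζ
  apply sectorUnitWeight_eq_zero
  rw [abs_div, abs_of_pos hw, le_div_iff₀ hw]
  linarith

omit hμ₁ hμ₂ in
/-- **On the CLOSURE of the support**: `‖k⃗‖ ≥ √((4+μ)/2)` and the relative angle is `≤ ¾ w_n` (`< π`: off the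
cut). [cite: BenfattoGiulianiMastropietro2006, §2.5 (2.45)–(2.50)] -/
theorem closure_sectorSymbol_region {e₀ : ℝ} (he : 0 < e₀) (he' : e₀ ≤ (4 + μ) / 2) {n : ℕ} {ω : ℤ}
    {p : ℝ × (Fin 2 → ℝ)} (hp : p ∈ closure {p | sectorSymbol e₀ μ n ω p ≠ 0}) :
    Real.sqrt ((4 + μ) / 2) ≤ ‖momToComplex p.2‖ ∧
      |sectorRelAngle (((ω : ℝ) + 1 / 2) * sectorWidth n) p.2| ≤ 3 * sectorWidth n / 4 := by
  have hw := sectorWidth_pos n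
  have hwπ := sectorWidth_le_pi n
  have hr₀ : 0 < Real.sqrt ((4 + μ) / 2) := Real.sqrt_pos.2 (by linarith)
  have h34 : 3 * sectorWidth n / 4 ≤ π := by linarith
  -- the closed superset described by continuous functions of `u = (k₁+ik₂)e^{-iθ₀}`
  obtain ⟨S, hSdef⟩ : ∃ S : Set (ℝ × (Fin 2 → ℝ)), S = {p : ℝ × (Fin 2 → ℝ) | Real.sqrt ((4 + μ) / 2) ≤ ‖momToComplex p.2‖ ∧
      ‖momToComplex p.2 * exp (-(((((ω : ℝ) + 1 / 2) * sectorWidth n : ℝ) : ℂ) * I))‖ * Real.cos (3 * sectorWidth n / 4) ≤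
        (momToComplex p.2 * exp (-(((((ω : ℝ) + 1 / 2) * sectorWidth n : ℝ) : ℂ) * I))).re} := ⟨_, rfl⟩
  have hcont : Continuous fun p : ℝ × (Fin 2 → ℝ) =>
      momToComplex p.2 * exp (-(((((ω : ℝ) + 1 / 2) * sectorWidth n : ℝ) : ℂ) * I)) :=
    ((contDiff_momToComplex (m := 0)).continuous.comp continuous_snd).mul continuous_const
  have hS : IsClosed S := by
    rw [hSdef, Set.setOf_and]
    refine IsClosed.inter ?_ ?_
    · exact isClosed_le continuous_const
        (continuous_norm.comp ((contDiff_momToComplex (m := 0)).continuous.comp continuous_snd))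
    · exact isClosed_le (hcont.norm.mul continuous_const) (Complex.continuous_re.comp hcont)
  have hsub : closure {p : ℝ × (Fin 2 → ℝ) | sectorSymbol e₀ μ n ω p ≠ 0} ⊆ S := by
    refine closure_minimal (fun p hp' => ?_) hS
    rw [hSdef]
    obtain ⟨hr, hΘ⟩ := sectorSymbol_ne_zero_region he he' hp'
    refine ⟨hr, ?_⟩
    have hu : momToComplex p.2 * exp (-(((((ω : ℝ) + 1 / 2) * sectorWidth n : ℝ) : ℂ) * I)) ≠ 0 := by
      rw [← norm_pos_iff, norm_mul_exp_neg_mul_I]; exact hr₀.trans_le hr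
    have hcos := cos_le_re_div_norm_of_abs_arg_le hu h34 hΘ.le
    rwa [le_div_iff₀ (norm_pos_iff.2 hu), mul_comm] at hcos
  have hpS := hsub hp
  rw [hSdef] at hpS
  obtain ⟨hr, hre⟩ := hpS
  refine ⟨hr, ?_⟩
  have hu : momToComplex p.2 * exp (-(((((ω : ℝ) + 1 / 2) * sectorWidth n : ℝ) : ℂ) * I)) ≠ 0 := by
    rw [← norm_pos_iff, norm_mul_exp_neg_mul_I]; exact hr₀.trans_le hr
  by_contra hc
  rw [not_le] at hc
  have h1 := re_div_norm_le_cos_of_le_abs_arg hu (abs_nonneg _) le_rfl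
  have h2 : Real.cos |sectorRelAngle (((ω : ℝ) + 1 / 2) * sectorWidth n) p.2| < Real.cos (3 * sectorWidth n / 4) :=
    Real.cos_lt_cos_of_nonneg_of_le_pi (by positivity) ((abs_sectorRelAngle_le _ _)) hc
  have h3 : (momToComplex p.2 * exp (-(((((ω : ℝ) + 1 / 2) * sectorWidth n : ℝ) : ℂ) * I))).re <
      ‖momToComplex p.2 * exp (-(((((ω : ℝ) + 1 / 2) * sectorWidth n : ℝ) : ℂ) * I))‖ * Real.cos (3 * sectorWidth n / 4) := by
    rw [← div_lt_iff₀' (norm_pos_iff.2 hu)]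
    exact lt_of_le_of_lt h1 h2
  linarith

end Region

/-! ### All-order line bounds of the product symbol -/

section Product

variable {μ : ℝ} (hμ₁ : -4 < μ) (hμ₂ : μ < -2 - Real.sqrt 2)
include hμ₁ hμ₂

/-- `2ⁿ‖w⃗‖ ≤ 2ρ(w)` for the direction cost of any sector frame. [folklore] -/
theorem two_pow_mul_norm_momToComplex_le (n : ℕ) (θ₀ : ℝ) (w : ℝ × (Fin 2 → ℝ)) :
    (2 : ℝ) ^ n * ‖momToComplex w.2‖ ≤ 2 * ((4 : ℝ) ^ n * |w.1| + (4 : ℝ) ^ n * |fermiNormal μ θ₀ 0 * w.2 0 + fermiNormal μ θ₀ 1 * w.2 1| +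
      (2 : ℝ) ^ n * |fermiTangent μ θ₀ 0 * w.2 0 + fermiTangent μ θ₀ 1 * w.2 1|) := by
  have h0 := abs_component_le_frame hμ₁ hμ₂ θ₀ w.2 0
  have h1 := abs_component_le_frame hμ₁ hμ₂ θ₀ w.2 1
  have hm := norm_momToComplex_le w.2
  have hy : (0 : ℝ) ≤ 2 ^ n := by positivity
  have hyx : (2 : ℝ) ^ n ≤ 4 ^ n := pow_le_pow_left₀ (by norm_num) (by norm_num) n
  have ha : 0 ≤ |fermiNormal μ θ₀ 0 * w.2 0 + fermiNormal μ θ₀ 1 * w.2 1| := abs_nonneg _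
  have ht : 0 ≤ |w.1| := abs_nonneg _
  have hx : (0 : ℝ) ≤ 4 ^ n := by positivity
  nlinarith [mul_le_mul_of_nonneg_left (hm.trans (add_le_add h0 h1)) hy, mul_le_mul_of_nonneg_right hyx ha,
    mul_nonneg hx ht]

/-- **All-order line bounds of the product symbol `σ_ω · (Â_{ω₁}Â_{ω₂})`** (`Â` = radial plateau × angular
cutoff): for every `N` there is `B' ≥ 0` with `‖∂ₛⁱ[…](q + s w)‖ ≤ 4ⁿ B' ρ_ω(w)ⁱ` for all `i ≤ N`, all scales,
sectors `ω < 2^{n+1}`, all `ω₁, ω₂ ∈ ℤ`, `q, w, s`. [cite: BenfattoGiulianiMastropietro2006, §2.7 (2.71a)] -/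
theorem exists_allorder_sectorProductSymbol_line_le {e₀ : ℝ} (he : 0 < e₀) (he' : e₀ ≤ (4 + μ) / 2) (N : ℕ) :
    ∃ B' : ℝ, 0 ≤ B' ∧ ∀ (i : ℕ), i ≤ N → ∀ (n : ℕ) (ω : ℕ), ω < sectorCount n → ∀ (ω₁ ω₂ : ℤ)
      (q w : ℝ × (Fin 2 → ℝ)) (s : ℝ),
      ‖iteratedDeriv i (fun s : ℝ => sectorSymbol e₀ μ n ω (q + s • w) *
          (((radialCutoffC (Real.sqrt ((4 + μ) / 2) / 2) (momToComplex (q + s • w).2) *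
              sectorWeightCirc n ω₁ (polarAngle (q + s • w).2)) *
            (radialCutoffC (Real.sqrt ((4 + μ) / 2) / 2) (momToComplex (q + s • w).2) *
              sectorWeightCirc n ω₂ (polarAngle (q + s • w).2)) : ℝ) : ℂ)) s‖ ≤
        (4 : ℝ) ^ n * B' * ((4 : ℝ) ^ n * |w.1| +
          (4 : ℝ) ^ n * |fermiNormal μ (((ω : ℝ) + 1 / 2) * sectorWidth n) 0 * w.2 0 +
            fermiNormal μ (((ω : ℝ) + 1 / 2) * sectorWidth n) 1 * w.2 1| +
          (2 : ℝ) ^ n * |fermiTangent μ (((ω : ℝ) + 1 / 2) * sectorWidth n) 0 * w.2 0 +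
            fermiTangent μ (((ω : ℝ) + 1 / 2) * sectorWidth n) 1 * w.2 1|) ^ i := by
  obtain ⟨Bσ, hBσ0, hBσ⟩ := exists_allorder_sectorSymbol_line_le hμ₁ hμ₂ he he' N
  obtain ⟨Ba, hBa0, hBa⟩ := exists_norm_iteratedDeriv_sectorWeightCirc_polarAngle_line_le' N
  -- constants: `r₀ = √((4+μ)/2)`, angular cost factor `K = max 1 (2(1+N!)/r₀)`, per-factor constant `A₁ = Ba Kᴺ`
  have hr₀ : 0 < Real.sqrt ((4 + μ) / 2) := Real.sqrt_pos.2 (by linarith)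
  obtain ⟨K, hK⟩ : ∃ K : ℝ, K = max 1 (2 * (1 + N !) / Real.sqrt ((4 + μ) / 2)) := ⟨_, rfl⟩
  have hK1 : 1 ≤ K := by rw [hK]; exact le_max_left _ _
  have hK0 : 0 ≤ K := zero_le_one.trans hK1
  refine ⟨4 ^ N * Bσ * (Ba * K ^ N) ^ 2, by positivity, fun i hi n ω hω ω₁ ω₂ q w s => ?_⟩
  -- the direction cost
  obtain ⟨ρ, hρ⟩ : ∃ ρ : ℝ, ρ = (4 : ℝ) ^ n * |w.1| +
      (4 : ℝ) ^ n * |fermiNormal μ (((ω : ℝ) + 1 / 2) * sectorWidth n) 0 * w.2 0 +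
        fermiNormal μ (((ω : ℝ) + 1 / 2) * sectorWidth n) 1 * w.2 1| +
      (2 : ℝ) ^ n * |fermiTangent μ (((ω : ℝ) + 1 / 2) * sectorWidth n) 0 * w.2 0 +
        fermiTangent μ (((ω : ℝ) + 1 / 2) * sectorWidth n) 1 * w.2 1| := ⟨_, rfl⟩
  rw [← hρ]
  have hρ0 : 0 ≤ ρ := by rw [hρ]; positivity
  have hx : (0 : ℝ) ≤ 4 ^ n := by positivity
  by_cases hcl : q + s • w ∈ closure {p : ℝ × (Fin 2 → ℝ) | sectorSymbol e₀ μ n (ω : ℤ) p ≠ 0}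
  · -- the region
    obtain ⟨hr, hΘ⟩ := closure_sectorSymbol_region he he' hcl
    have hΘπ : |sectorRelAngle ((((ω : ℤ) : ℝ) + 1 / 2) * sectorWidth n) (q + s • w).2| < π := by
      have hw := sectorWidth_pos n
      have hwπ := sectorWidth_le_pi n
      exact lt_of_le_of_lt hΘ (by linarith)
    -- the two angular factors: smooth lines, bounds `A₁ ρʲ`
    have hcost : (1 + (N ! : ℝ)) * 2 ^ n * ‖momToComplex w.2‖ / Real.sqrt ((4 + μ) / 2) ≤
        (2 * (1 + N !) / Real.sqrt ((4 + μ) / 2)) * ρ := by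
      have h2 := two_pow_mul_norm_momToComplex_le hμ₁ hμ₂ n (((ω : ℝ) + 1 / 2) * sectorWidth n) w
      rw [← hρ] at h2
      calc (1 + (N ! : ℝ)) * 2 ^ n * ‖momToComplex w.2‖ / Real.sqrt ((4 + μ) / 2)
          = (1 + N !) / Real.sqrt ((4 + μ) / 2) * (2 ^ n * ‖momToComplex w.2‖) := by ring
        _ ≤ (1 + N !) / Real.sqrt ((4 + μ) / 2) * (2 * ρ) := mul_le_mul_of_nonneg_left h2 (by positivity)
        _ = (2 * (1 + N !) / Real.sqrt ((4 + μ) / 2)) * ρ := by ring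
    have hcK : 2 * (1 + (N ! : ℝ)) / Real.sqrt ((4 + μ) / 2) ≤ K := by rw [hK]; exact le_max_right _ _
    have hang : ∀ (ω' : ℤ) (j : ℕ), j ≤ i →
        ‖iteratedDeriv j (fun s : ℝ => radialCutoffC (Real.sqrt ((4 + μ) / 2) / 2) (momToComplex (q + s • w).2) *
          sectorWeightCirc n ω' (polarAngle (q + s • w).2)) s‖ ≤ Ba * K ^ N * ρ ^ j := by
      intro ω' j hj
      -- near `s` the radial plateau is `1`
      have hopen : IsOpen {s' : ℝ | Real.sqrt ((4 + μ) / 2) / 2 < ‖momToComplex (q + s' • w).2‖} :=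
        isOpen_lt continuous_const (continuous_norm.comp ((contDiff_momToComplex (m := 0)).continuous.comp
          (continuous_snd.comp (by fun_prop))))
      have hmem : s ∈ {s' : ℝ | Real.sqrt ((4 + μ) / 2) / 2 < ‖momToComplex (q + s' • w).2‖} := by
        show Real.sqrt ((4 + μ) / 2) / 2 < ‖momToComplex (q + s • w).2‖
        linarith
      have hev : (fun s : ℝ => radialCutoffC (Real.sqrt ((4 + μ) / 2) / 2) (momToComplex (q + s • w).2) *
          sectorWeightCirc n ω' (polarAngle (q + s • w).2)) =ᶠ[𝓝 s]
          fun s : ℝ => sectorWeightCirc n ω' (polarAngle (q.2 + s • w.2)) := by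
        filter_upwards [hopen.mem_nhds hmem] with s' hs'
        rw [radialCutoffC_eq_one (by positivity) hs'.le, one_mul]
        rfl
      rw [(hev.iteratedDeriv j).eq_of_nhds]
      have h := hBa j (hj.trans hi) n ω' (((ω : ℝ) + 1 / 2) * sectorWidth n) q.2 w.2 s hr₀ hr (by
        have : (((ω : ℤ) : ℝ) + 1 / 2) * sectorWidth n = ((ω : ℝ) + 1 / 2) * sectorWidth n := by push_cast; ring
        rw [this] at hΘπ; exact hΘπ)
      refine h.trans ?_
      rw [mul_assoc Ba]
      refine mul_le_mul_of_nonneg_left ?_ hBa0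
      calc ((1 + (N ! : ℝ)) * 2 ^ n * ‖momToComplex w.2‖ / Real.sqrt ((4 + μ) / 2)) ^ j
          ≤ ((2 * (1 + N !) / Real.sqrt ((4 + μ) / 2)) * ρ) ^ j := pow_le_pow_left₀ (by positivity) hcost j
        _ ≤ (max 1 (2 * (1 + N !) / Real.sqrt ((4 + μ) / 2))) ^ N * ρ ^ j :=
            mul_pow_le_max_pow_mul (by positivity) hρ0 (hj.trans hi)
        _ = K ^ N * ρ ^ j := by rw [← hK]
    -- smoothness of the angular lines
    have hline : ∀ m : ℕ, ContDiff ℝ m (fun s : ℝ => (q + s • w).2) := by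
      intro m
      have : (fun s : ℝ => (q + s • w).2) = fun s : ℝ => q.2 + s • w.2 := rfl
      rw [this]; fun_prop
    have hsm : ∀ (ω' : ℤ) (m : ℕ), ContDiff ℝ m (fun s : ℝ => radialCutoffC (Real.sqrt ((4 + μ) / 2) / 2)
        (momToComplex (q + s • w).2) * sectorWeightCirc n ω' (polarAngle (q + s • w).2)) := fun ω' m =>
      ((contDiff_radial_mul_sectorWeightCirc_polarAngle (by positivity) n ω' (m := m)).comp (hline m))
    -- the real product of the two angular factors: `≤ 2ᴺ A₁² ρʲ`
    have hprod : ∀ j ≤ i, ‖iteratedDeriv j (fun s : ℝ =>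
        (radialCutoffC (Real.sqrt ((4 + μ) / 2) / 2) (momToComplex (q + s • w).2) * sectorWeightCirc n ω₁ (polarAngle (q + s • w).2)) *
        (radialCutoffC (Real.sqrt ((4 + μ) / 2) / 2) (momToComplex (q + s • w).2) * sectorWeightCirc n ω₂ (polarAngle (q + s • w).2))) s‖ ≤
        2 ^ N * (Ba * K ^ N) ^ 2 * ρ ^ j := by
      intro j hj
      have h := norm_iteratedDeriv_mul_le_of_geometric (hsm ω₁ j) (hsm ω₂ j) s hρ0
        (fun j' hj' => hang ω₁ j' (hj'.trans hj)) (fun j' hj' => hang ω₂ j' (hj'.trans hj))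
      refine h.trans ?_
      have h2 : (2 : ℝ) ^ j ≤ 2 ^ N := pow_le_pow_right₀ (by norm_num) (hj.trans hi)
      have h0 : 0 ≤ Ba * K ^ N := by positivity
      calc (2 : ℝ) ^ j * (Ba * K ^ N) * (Ba * K ^ N) * ρ ^ j = 2 ^ j * ((Ba * K ^ N) ^ 2 * ρ ^ j) := by ring
        _ ≤ 2 ^ N * ((Ba * K ^ N) ^ 2 * ρ ^ j) := mul_le_mul_of_nonneg_right h2 (by positivity)
        _ = 2 ^ N * (Ba * K ^ N) ^ 2 * ρ ^ j := by ring
    -- the complexified angular product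
    have hreal : ∀ m : ℕ, ContDiff ℝ m (fun s : ℝ =>
        (radialCutoffC (Real.sqrt ((4 + μ) / 2) / 2) (momToComplex (q + s • w).2) * sectorWeightCirc n ω₁ (polarAngle (q + s • w).2)) *
        (radialCutoffC (Real.sqrt ((4 + μ) / 2) / 2) (momToComplex (q + s • w).2) * sectorWeightCirc n ω₂ (polarAngle (q + s • w).2))) :=
      fun m => (hsm ω₁ m).mul (hsm ω₂ m)
    have hcplx : ∀ j ≤ i, ‖iteratedDeriv j (fun s : ℝ => (((radialCutoffC (Real.sqrt ((4 + μ) / 2) / 2)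
        (momToComplex (q + s • w).2) * sectorWeightCirc n ω₁ (polarAngle (q + s • w).2)) *
        (radialCutoffC (Real.sqrt ((4 + μ) / 2) / 2) (momToComplex (q + s • w).2) *
          sectorWeightCirc n ω₂ (polarAngle (q + s • w).2)) : ℝ) : ℂ)) s‖ ≤ 2 ^ N * (Ba * K ^ N) ^ 2 * ρ ^ j := by
      intro j hj
      have h := norm_iteratedDeriv_ofReal_comp (hreal j) s
      rw [← Real.norm_eq_abs] at h
      exact (le_of_eq h).trans (hprod j hj)
    have hcplxs : ContDiff ℝ i (fun s : ℝ => (((radialCutoffC (Real.sqrt ((4 + μ) / 2) / 2)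
        (momToComplex (q + s • w).2) * sectorWeightCirc n ω₁ (polarAngle (q + s • w).2)) *
        (radialCutoffC (Real.sqrt ((4 + μ) / 2) / 2) (momToComplex (q + s • w).2) *
          sectorWeightCirc n ω₂ (polarAngle (q + s • w).2)) : ℝ) : ℂ)) :=
      Complex.ofRealCLM.contDiff.comp (hreal i)
    -- the sector symbol
    have hσ : ContDiff ℝ i fun s : ℝ => sectorSymbol e₀ μ n (ω : ℤ) (q + s • w) :=
      contDiff_lineRestriction (contDiff_sectorSymbol hμ₁ hμ₂ he he' n (ω : ℤ)) q w
    have hA : ∀ j ≤ i, ‖iteratedDeriv j (fun s : ℝ => sectorSymbol e₀ μ n (ω : ℤ) (q + s • w)) s‖ ≤ (4 : ℝ) ^ n * Bσ * ρ ^ j := by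
      intro j hj
      have h := hBσ j (hj.trans hi) n ω hω q w s
      rwa [← hρ] at h
    -- Leibniz
    exact (norm_iteratedDeriv_mul_le_of_geometric hσ hcplxs s hρ0 hA hcplx).trans
      (leibniz_product_constant_arith hx hBσ0 (by positivity) (pow_nonneg hρ0 i) hi)
  · -- off the closure of the support everything vanishes
    rw [iteratedDeriv_line_mul_eq_zero_of_not_mem_closure (S := {p | sectorSymbol e₀ μ n (ω : ℤ) p ≠ 0})
      (a := fun p => sectorSymbol e₀ μ n (ω : ℤ) p)
      (b := fun p : ℝ × (Fin 2 → ℝ) => ((((radialCutoffC (Real.sqrt ((4 + μ) / 2) / 2) (momToComplex p.2) *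
              sectorWeightCirc n ω₁ (polarAngle p.2)) *
            (radialCutoffC (Real.sqrt ((4 + μ) / 2) / 2) (momToComplex p.2) *
              sectorWeightCirc n ω₂ (polarAngle p.2)) : ℝ) : ℂ)))
      (fun p hp => by simpa using hp) q w hcl i, norm_zero]
    positivity

end Product

/-! ### The torus sums of the product symbol -/

section Main

variable {μ : ℝ} (hμ₁ : -4 < μ) (hμ₂ : μ < -2 - Real.sqrt 2)
include hμ₁ hμ₂

set_option maxHeartbeats 400000 in
-- the instantiation of `torusCharSum_bounds_of_symbolClass` with the product symbol is large
/-- **BGM Lemma 2.2 on the discrete torus for the sectorised covariance symbols `σ_ω ζ̃_{ω₁} ζ̃_{ω₂}`**: for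
`0 < e₀ ≤ (4+μ)/2` and `N ≥ N_w + 7` there is `C` such that for all scales `n`, sectors `ω < 2^{n+1}`, ALL angular
indices `ω₁, ω₂ ∈ ℤ`, inverse temperatures `β` with `3π4ⁿ ≤ e₀β`, and tori `L, M` with `β ≤ M`, `βe₀ ≤ 2π(M-N)`,
`64(N+1)16ⁿ ≤ L`, the character sums `S(z)` of the sampled product symbol obey
`‖S(z)‖ ≤ C βL² 4^{-n}2^{-n}` and `(β/2M) Σ_z (1 + (β/(π4ⁿM))|z̃₀| + (1/(π4ⁿ))(|z̃₁|+|z̃₂|))^{N_w} ‖S(z)‖ ≤ C βL² 4ⁿ`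
— the bounds (2.50)/(2.52) (`|g| ≤ Cγ^{3h/2}`, `∫(1+γ^h|x|)^{N}|g| ≤ Cγ^{-h}`) for every entry of the sectorised
covariance `F̃_ω F̃_{ω'} g^{(h)}`, uniformly in `h, ω, ω₁, ω₂, β, L, M`. [cite: BenfattoGiulianiMastropietro2006, §2.7 (2.66)–(2.71a)] -/
theorem torusSectorProductSum_bounds {e₀ : ℝ} (he : 0 < e₀) (he' : e₀ ≤ (4 + μ) / 2) {N Nw : ℕ} (hN : Nw + 7 ≤ N) :
    ∃ C : ℝ, 0 ≤ C ∧ ∀ (n : ℕ) (ω : ℕ), ω < sectorCount n → ∀ (ω₁ ω₂ : ℤ) (β : ℝ), 0 < β → 3 * π * 4 ^ n ≤ e₀ * β →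
      ∀ (L M : ℕ) [NeZero L] [NeZero M], β ≤ M → β * e₀ ≤ 2 * π * ((M : ℝ) - N) →
      64 * ((N : ℝ) + 1) * 16 ^ n ≤ L →
      (∀ z : TorusSite 1 (2 * M) × TorusSite 2 L,
        ‖∑ p : TorusSite 1 (2 * M) × TorusSite 2 L, (torusChar p.1 z.1 * torusChar p.2 z.2) •
            (sectorSymbol e₀ μ n ω (π * (1 - 2 * M) / β + 2 * π / β * (((p.1 0).val : ℕ) : ℝ),
                fun j => 2 * π / L * (((p.2 j).valMinAbs : ℤ) : ℝ)) *
              ((sectorWeightCirc n ω₁ (polarAngle fun j => 2 * π / L * (((p.2 j).valMinAbs : ℤ) : ℝ)) *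
                sectorWeightCirc n ω₂ (polarAngle fun j => 2 * π / L * (((p.2 j).valMinAbs : ℤ) : ℝ)) : ℝ) : ℂ))‖ ≤
          C * (β * (L : ℝ) ^ 2) * ((4 : ℝ) ^ n)⁻¹ * ((2 : ℝ) ^ n)⁻¹) ∧
      β / (2 * M) * ∑ z : TorusSite 1 (2 * M) × TorusSite 2 L,
        (1 + β / (π * 4 ^ n * M) * |(((z.1 0).valMinAbs : ℤ) : ℝ)| +
            1 / (π * 4 ^ n) * (|(((z.2 0).valMinAbs : ℤ) : ℝ)| + |(((z.2 1).valMinAbs : ℤ) : ℝ)|)) ^ Nw *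
          ‖∑ p : TorusSite 1 (2 * M) × TorusSite 2 L, (torusChar p.1 z.1 * torusChar p.2 z.2) •
            (sectorSymbol e₀ μ n ω (π * (1 - 2 * M) / β + 2 * π / β * (((p.1 0).val : ℕ) : ℝ),
                fun j => 2 * π / L * (((p.2 j).valMinAbs : ℤ) : ℝ)) *
              ((sectorWeightCirc n ω₁ (polarAngle fun j => 2 * π / L * (((p.2 j).valMinAbs : ℤ) : ℝ)) *
                sectorWeightCirc n ω₂ (polarAngle fun j => 2 * π / L * (((p.2 j).valMinAbs : ℤ) : ℝ)) : ℝ) : ℂ))‖ ≤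
        C * (β * (L : ℝ) ^ 2) * (4 : ℝ) ^ n := by
  classical
  obtain ⟨B', hB'0, hB'⟩ := exists_allorder_sectorProductSymbol_line_le hμ₁ hμ₂ he he' N
  have hC₁0 : 0 ≤ normalExtentConst μ e₀ := by
    have h := normalExtent_nonneg hμ₁ hμ₂ he 0
    rw [normalExtent_eq] at h
    simpa using h
  have hC₂0 : 0 ≤ tangentExtentConst μ e₀ := by
    have h := (tangentExtent_nonneg hμ₁ he 0).trans (tangentExtent_le hμ₁ he.le 0)
    simpa using h
  have hA₀ : (0 : ℝ) ≤ 16 / e₀ := by positivity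
  obtain ⟨C, hC0, hC⟩ := torusCharSum_bounds_of_symbolClass (E := ℂ) hN hB'0 hA₀ he hC₁0 hC₂0
  refine ⟨C, hC0, fun n ω hω ω₁ ω₂ β hβ hβn L M _ _ hβM hM hL => ?_⟩
  have hr₀ : 0 < Real.sqrt ((4 + μ) / 2) := Real.sqrt_pos.2 (by linarith)
  have hr₀' : 0 < Real.sqrt ((4 + μ) / 2) / 2 := by positivity
  -- the smooth product symbol (radial plateaux inserted)
  obtain ⟨Φ, hΦ⟩ : ∃ Φ : ℝ × (Fin 2 → ℝ) → ℂ, Φ = fun p => sectorSymbol e₀ μ n ω p *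
      (((radialCutoffC (Real.sqrt ((4 + μ) / 2) / 2) (momToComplex p.2) * sectorWeightCirc n ω₁ (polarAngle p.2)) *
        (radialCutoffC (Real.sqrt ((4 + μ) / 2) / 2) (momToComplex p.2) * sectorWeightCirc n ω₂ (polarAngle p.2)) : ℝ) : ℂ) :=
    ⟨_, rfl⟩
  -- it IS the product symbol
  have hΦA : ∀ p, Φ p = sectorSymbol e₀ μ n ω p *
      ((sectorWeightCirc n ω₁ (polarAngle p.2) * sectorWeightCirc n ω₂ (polarAngle p.2) : ℝ) : ℂ) := by
    intro p
    rw [hΦ]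
    dsimp only
    by_cases hσ : sectorSymbol e₀ μ n ω p = 0
    · rw [hσ, zero_mul, zero_mul]
    · obtain ⟨hr, -⟩ := sectorSymbol_ne_zero_region he he' hσ
      rw [radialCutoffC_eq_one hr₀' (by linarith), one_mul, one_mul]
  -- the frame at the sector centre
  obtain ⟨hn0, hn1⟩ : fermiNormal μ (((ω : ℝ) + 1 / 2) * sectorWidth n) 0 = fermiTangent μ (((ω : ℝ) + 1 / 2) * sectorWidth n) 1 ∧
      fermiNormal μ (((ω : ℝ) + 1 / 2) * sectorWidth n) 1 = -fermiTangent μ (((ω : ℝ) + 1 / 2) * sectorWidth n) 0 := by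
    simp [fermiNormal, fermiTangent]
  have htan1 := fermiTangent_normSq hμ₁ hμ₂ (((ω : ℝ) + 1 / 2) * sectorWidth n)
  -- smoothness
  have hreal : ContDiff ℝ N (fun p : ℝ × (Fin 2 → ℝ) =>
      (radialCutoffC (Real.sqrt ((4 + μ) / 2) / 2) (momToComplex p.2) * sectorWeightCirc n ω₁ (polarAngle p.2)) *
        (radialCutoffC (Real.sqrt ((4 + μ) / 2) / 2) (momToComplex p.2) * sectorWeightCirc n ω₂ (polarAngle p.2))) :=
    ((contDiff_radial_mul_sectorWeightCirc_polarAngle hr₀' n ω₁).mul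
      (contDiff_radial_mul_sectorWeightCirc_polarAngle hr₀' n ω₂)).comp contDiff_snd
  have hcplx : ContDiff ℝ N (fun p : ℝ × (Fin 2 → ℝ) =>
      (((radialCutoffC (Real.sqrt ((4 + μ) / 2) / 2) (momToComplex p.2) * sectorWeightCirc n ω₁ (polarAngle p.2)) *
        (radialCutoffC (Real.sqrt ((4 + μ) / 2) / 2) (momToComplex p.2) * sectorWeightCirc n ω₂ (polarAngle p.2)) : ℝ) : ℂ)) := by
    have h := Complex.ofRealCLM.contDiff.comp hreal
    simpa only [Function.comp_def, Complex.ofRealCLM_apply] using h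
  have hΦs : ContDiff ℝ N Φ := by
    rw [hΦ]; exact (contDiff_sectorSymbol hμ₁ hμ₂ he he' n (ω : ℤ)).mul hcplx
  -- the line bound
  have hline : ∀ (q w : ℝ × (Fin 2 → ℝ)) (s : ℝ), ‖iteratedDeriv N (fun s : ℝ => Φ (q + s • w)) s‖ ≤
      (4 : ℝ) ^ n * B' * ((4 : ℝ) ^ n * |w.1| +
        (4 : ℝ) ^ n * |fermiNormal μ (((ω : ℝ) + 1 / 2) * sectorWidth n) 0 * w.2 0 +
          fermiNormal μ (((ω : ℝ) + 1 / 2) * sectorWidth n) 1 * w.2 1| +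
        (2 : ℝ) ^ n * |fermiTangent μ (((ω : ℝ) + 1 / 2) * sectorWidth n) 0 * w.2 0 +
          fermiTangent μ (((ω : ℝ) + 1 / 2) * sectorWidth n) 1 * w.2 1|) ^ N := by
    intro q w s
    rw [hΦ]
    exact hB' N le_rfl n ω hω ω₁ ω₂ q w s
  -- the sup
  have h16 : (e₀ * (4 : ℝ) ^ (-(n : ℤ) - 2))⁻¹ = 16 / e₀ * 4 ^ n := by
    rw [show (-(n : ℤ) - 2) = -((n + 2 : ℕ) : ℤ) by push_cast; ring, zpow_neg, zpow_natCast, mul_inv, inv_inv,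
      pow_add]
    ring
  have hsup : ∀ p, ‖Φ p‖ ≤ 16 / e₀ * (4 : ℝ) ^ n := by
    intro p
    rw [hΦ]
    dsimp only
    rw [norm_mul]
    have h1 := norm_sectorSymbol_le (μ := μ) he n (ω : ℤ) p
    have hR := radialCutoffC_mem_Icc (Real.sqrt ((4 + μ) / 2) / 2) (momToComplex p.2)
    have hz1 := sectorWeightCirc_nonneg n ω₁ (polarAngle p.2)
    have hz1' := sectorWeightCirc_le_one n ω₁ (polarAngle p.2)
    have hz2 := sectorWeightCirc_nonneg n ω₂ (polarAngle p.2)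
    have hz2' := sectorWeightCirc_le_one n ω₂ (polarAngle p.2)
    have h2 : ‖(((radialCutoffC (Real.sqrt ((4 + μ) / 2) / 2) (momToComplex p.2) * sectorWeightCirc n ω₁ (polarAngle p.2)) *
        (radialCutoffC (Real.sqrt ((4 + μ) / 2) / 2) (momToComplex p.2) * sectorWeightCirc n ω₂ (polarAngle p.2)) : ℝ) : ℂ)‖ ≤ 1 := by
      rw [Complex.norm_real, Real.norm_of_nonneg (mul_nonneg (mul_nonneg hR.1 hz1) (mul_nonneg hR.1 hz2))]
      exact mul_le_one₀ (mul_le_one₀ hR.2 hz1 hz1') (mul_nonneg hR.1 hz2) (mul_le_one₀ hR.2 hz2 hz2')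
    calc ‖sectorSymbol e₀ μ n ω p‖ * _ ≤ (e₀ * (4 : ℝ) ^ (-(n : ℤ) - 2))⁻¹ * 1 :=
          mul_le_mul h1 h2 (norm_nonneg _) (by positivity)
      _ = 16 / e₀ * 4 ^ n := by rw [mul_one, h16]
  -- the support
  have hsupp : ∀ p : ℝ × (Fin 2 → ℝ), Φ p ≠ 0 →
      |p.1| ≤ e₀ * ((4 : ℝ) ^ n)⁻¹ ∧
        |(p.2 0 - ![fermiX μ (((ω : ℝ) + 1 / 2) * sectorWidth n), fermiY μ (((ω : ℝ) + 1 / 2) * sectorWidth n)] 0) *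
              fermiNormal μ (((ω : ℝ) + 1 / 2) * sectorWidth n) 0 +
            (p.2 1 - ![fermiX μ (((ω : ℝ) + 1 / 2) * sectorWidth n), fermiY μ (((ω : ℝ) + 1 / 2) * sectorWidth n)] 1) *
              fermiNormal μ (((ω : ℝ) + 1 / 2) * sectorWidth n) 1| ≤ normalExtentConst μ e₀ * ((4 : ℝ) ^ n)⁻¹ ∧
        |(p.2 0 - ![fermiX μ (((ω : ℝ) + 1 / 2) * sectorWidth n), fermiY μ (((ω : ℝ) + 1 / 2) * sectorWidth n)] 0) *
              fermiTangent μ (((ω : ℝ) + 1 / 2) * sectorWidth n) 0 +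
            (p.2 1 - ![fermiX μ (((ω : ℝ) + 1 / 2) * sectorWidth n), fermiY μ (((ω : ℝ) + 1 / 2) * sectorWidth n)] 1) *
              fermiTangent μ (((ω : ℝ) + 1 / 2) * sectorWidth n) 1| ≤ tangentExtentConst μ e₀ * ((2 : ℝ) ^ n)⁻¹ ∧
        ∀ j, |p.2 j| ≤ π / 2 := by
    intro p hp
    have hσ : sectorSymbol e₀ μ n ω p ≠ 0 := by
      intro h0; apply hp; rw [hΦ]; dsimp only; rw [h0, zero_mul]
    obtain ⟨h0, hnrm, htan, hz⟩ := sectorSymbol_support hμ₁ hμ₂ he he' hσ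
    simp only [Int.cast_natCast, zpow_neg, zpow_natCast] at h0 hnrm htan
    simp only [Matrix.cons_val_zero, Matrix.cons_val_one]
    exact ⟨h0, hnrm, htan, hz⟩
  have hmain := hC n Φ (fermiNormal μ (((ω : ℝ) + 1 / 2) * sectorWidth n)) (fermiTangent μ (((ω : ℝ) + 1 / 2) * sectorWidth n))
    ![fermiX μ (((ω : ℝ) + 1 / 2) * sectorWidth n), fermiY μ (((ω : ℝ) + 1 / 2) * sectorWidth n)] htan1 hn0 hn1 hΦs hline
    hsup hsupp β hβ hβn L M hβM hM hL
  simp only [hΦA] at hmain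
  exact hmain

end Main

end Literature.MathematicalPhysics.QuantumLattice
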